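/-
Origin: expansion seat `planner-pub-hodgecm-pv02-0`, handover 2026-08-18T03:41:34Z (`HOME/pub-hodgecm-pv02/lean/Pv02/PerL34/Isotypic.lean`, md5 68f6e794, 274 lines);
landed by the gen-5 packager in gate run 19 as `HodgeCM/PerL34/Isotypic.lean` (verbatim).
-/
/-
Origin: HOME/pub-hodgecm-pv02/lean/Pv02/PerL34/Isotypic.lean — session planner-pub-hodgecm-pv02-0 (unit
pub-hodgecm-pv02, DAG-NODE PROVER #02).  Intended final place: `HodgeCM/PerL34/Isotypic.lean`.
Pure Mathlib.  KERNEL-PROVED core of DAG node N27 (PerL v5 Lemma 4.1(a), tex ll. 480–482, pf ll. 493–496: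
"only the `φ_b` in the corresponding isotypic parts contribute") and of the compact-place half of N31f
(tex ll. 612–615: `I_v(φ_v) = vol · ‖φ_v[χ̄'_v]‖²`).  Nothing is posited; no cited fact.
-/
import Mathlib
import Literature.RepresentationTheory.CompactGroups.IsotypicProjection

set_option autoImplicit false

/-!
# Isotypic projections for a compact group acting unitarily (core of N27 / N31f)

Let `K` be a topological group with a left-invariant probability measure `μ` (the normalised Haar measure of
a compact group), `ω : K →* (E ≃ₗᵢ[ℂ] E)` a unitary representation on a complex Hilbert space `E`, and
`χ : K →* Circle` a unitary character.  The **averaging operator**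
`proj μ ω χ v := ∫ k, (χ k : ℂ) • ω k v ∂μ`
is the projection onto the `χ̄`-isotypic subspace `isoSub ω χ := {v | ∀ k, ω k v = conj (χ k) • v}`:

* `apply_proj` : `ω g (proj v) = conj (χ g) • proj v` (so `proj v ∈ isoSub`);
* `proj_eq_self` : `proj v = v` for `v ∈ isoSub`;  `proj_proj` : idempotence;
* `lift_proj` : for every continuous linear `θ` with `θ (ω u φ) = (χ u)⁻¹ • θ φ` (PerL l. 493:
  `θ(ω(u)φ,χ') = χ'(u)⁻¹ θ(φ,χ')`) one has `θ (proj φ) = θ φ` — the lift FACTORS THROUGH the `χ̄`-isotypic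
  part ("only the `φ_b` in the corresponding isotypic parts contribute", l. 494);
* `lift_eq_zero_of_eigen` : purely algebraic form — if `K` acts on `φ` through a scalar function `c` with
  `c k ≠ (χ k)⁻¹` for some `k`, then `θ φ = 0`;
* `inner_proj_comm` : `proj` is self-adjoint (needs inversion-invariance of `μ`, automatic for compact or
  abelian groups);
* `integral_chi_inner_eq` : `∫ k, (χ k : ℂ) * ⟪φ, ω k φ⟫ ∂μ = ‖proj φ‖ ^ 2` — PerL v5 l. 612–615
  "`I_v(φ_v) = vol · ‖φ_v[χ̄'_v]‖²`" with `vol = 1`, hence `≥ 0`, and `> 0` iff the `χ̄`-isotypic component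
  of `φ` is non-zero (`integral_chi_inner_pos_iff`).
-/

noncomputable section

open MeasureTheory Complex ComplexConjugate
open scoped InnerProductSpace

namespace HodgeCM
namespace PerL34
namespace Isotypic

variable {K : Type*} [Group K]
variable {E : Type*} [NormedAddCommGroup E] [InnerProductSpace ℂ E]
variable {F : Type*} [NormedAddCommGroup F] [NormedSpace ℂ F] [CompleteSpace F]

/-- The `χ̄`-isotypic subspace of a representation `ω`: the vectors on which `K` acts by the character
`conj χ = χ⁻¹` (PerL v5 l. 614 "`φ_v[χ̄'_v]` the `χ̄'_v`-isotypic component"). -/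
def isoSub (ω : K →* (E ≃ₗᵢ[ℂ] E)) (χ : K →* Circle) : Submodule ℂ E where
  carrier := {v | ∀ k, ω k v = conj (χ k : ℂ) • v}
  add_mem' := by
    intro v w hv hw k
    simp only [Set.mem_setOf_eq] at hv hw ⊢
    rw [map_add, hv k, hw k, smul_add]
  zero_mem' := by
    intro k
    simp
  smul_mem' := by
    intro a v hv k
    simp only [Set.mem_setOf_eq] at hv ⊢
    rw [LinearIsometryEquiv.map_smul, hv k, smul_comm]

/-- (Ported verbatim from the HodgeCMPerL package; no docstring in the source.) -/
theorem mem_isoSub {ω : K →* (E ≃ₗᵢ[ℂ] E)} {χ : K →* Circle} {v : E} :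
    v ∈ isoSub ω χ ↔ ∀ k, ω k v = conj (χ k : ℂ) • v := Iff.rfl

section CircleLemmas

variable (χ : K →* Circle)

/-- `conj (χ k) * χ k = 1`. -/
alias conj_mul_coe := Literature.RepresentationTheory.CompactGroups.Isotypic.conj_mul_coe

/-- (Ported verbatim from the HodgeCMPerL package; no docstring in the source.) -/
alias coe_mul_conj := Literature.RepresentationTheory.CompactGroups.Isotypic.coe_mul_conj

/-- (Ported verbatim from the HodgeCMPerL package; no docstring in the source.) -/
alias coe_inv_eq_conj' := Literature.RepresentationTheory.CompactGroups.Isotypic.coe_inv_eq_conj'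

/-- (Ported verbatim from the HodgeCMPerL package; no docstring in the source.) -/
alias coe_map_inv := Literature.RepresentationTheory.CompactGroups.Isotypic.coe_map_inv

end CircleLemmas

variable [MeasurableSpace K]

/-- The averaging operator `v ↦ ∫ χ(k) • ω(k)v dμ(k)` (PerL v5 ll. 493–494, 614; adv2-C1(a):
`P_b := ∫_{U(W_{i,b})} χ'_b(u) ω(u) du`). -/
def proj (μ : Measure K) (ω : K →* (E ≃ₗᵢ[ℂ] E)) (χ : K →* Circle) (v : E) : E :=
  ∫ k, (χ k : ℂ) • ω k v ∂μ

variable (μ : Measure K) (ω : K →* (E ≃ₗᵢ[ℂ] E)) (χ : K →* Circle)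

/-- (Ported verbatim from the HodgeCMPerL package; no docstring in the source.) -/
theorem proj_def (v : E) : proj μ ω χ v = ∫ k, (χ k : ℂ) • ω k v ∂μ := rfl

section Equivariance

variable [MeasurableMul K] [μ.IsMulLeftInvariant]

/-- **Equivariance**: `ω g (proj v) = conj (χ g) • proj v` — the average is `χ̄`-isotypic.  (Left
invariance of `μ`; no continuity needed.) -/
theorem apply_proj (g : K) (v : E) : ω g (proj μ ω χ v) = conj (χ g : ℂ) • proj μ ω χ v := by
  have hcomm := (ω g).toContinuousLinearEquiv.integral_comp_comm (μ := μ) (fun k => (χ k : ℂ) • ω k v)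
  simp only [LinearIsometryEquiv.coe_toContinuousLinearEquiv] at hcomm
  rw [proj_def, ← hcomm]
  have h1 : (fun k => ω g ((χ k : ℂ) • ω k v)) =
      fun k => (fun k' => (χ (g⁻¹ * k') : ℂ) • ω k' v) (g * k) := by
    funext k
    simp only [LinearIsometryEquiv.map_smul, inv_mul_cancel_left, map_mul]
    rfl
  rw [h1, integral_mul_left_eq_self (fun k' => (χ (g⁻¹ * k') : ℂ) • ω k' v) g]
  have h2 : (fun k' => (χ (g⁻¹ * k') : ℂ) • ω k' v) = fun k' => conj (χ g : ℂ) • ((χ k' : ℂ) • ω k' v) := by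
    funext k'
    rw [map_mul, Circle.coe_mul, coe_map_inv, smul_smul]
  rw [h2, integral_smul]

/-- (Ported verbatim from the HodgeCMPerL package; no docstring in the source.) -/
theorem proj_mem (v : E) : proj μ ω χ v ∈ isoSub ω χ := fun g => apply_proj μ ω χ g v

end Equivariance

section Fixed

variable [CompleteSpace E] [IsProbabilityMeasure μ]

/-- On the `χ̄`-isotypic subspace the average is the identity. -/
theorem proj_eq_self {v : E} (hv : v ∈ isoSub ω χ) : proj μ ω χ v = v := by
  rw [proj_def]
  have : (fun k => (χ k : ℂ) • ω k v) = fun _ => v := by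
    funext k
    rw [hv k, smul_smul, coe_mul_conj, one_smul]
  rw [this, integral_const]
  simp

variable [MeasurableMul K] [μ.IsMulLeftInvariant]

/-- **Idempotence**: `proj (proj v) = proj v`. -/
theorem proj_proj (v : E) : proj μ ω χ (proj μ ω χ v) = proj μ ω χ v :=
  proj_eq_self μ ω χ (proj_mem μ ω χ v)

/-- The range of the average is exactly the `χ̄`-isotypic subspace. -/
theorem mem_isoSub_iff_proj_eq (v : E) : v ∈ isoSub ω χ ↔ proj μ ω χ v = v :=
  ⟨proj_eq_self μ ω χ, fun h => h ▸ proj_mem μ ω χ v⟩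

end Fixed

section Lift

omit [Group K] [MeasurableSpace K] in
/-- **Algebraic form of "only the corresponding isotypic parts contribute"** (PerL v5 ll. 493–495): if a
linear `θ` satisfies `θ (ω u φ) = (χ u)⁻¹ • θ φ` for all `u`, and `K` acts on the vector `φ` through scalars
`c k` with `c k ≠ (χ k)⁻¹` for some `k`, then `θ φ = 0`.  No measure, no topology. -/
alias lift_eq_zero_of_eigen := Literature.RepresentationTheory.CompactGroups.Isotypic.lift_eq_zero_of_eigen

variable [TopologicalSpace K] [OpensMeasurableSpace K] [CompactSpace K] [IsFiniteMeasureOnCompacts μ]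

/-- Integrability of the averaging integrand for a strongly continuous representation and a continuous
character on a compact group. -/
alias integrable_smul_apply := Literature.RepresentationTheory.CompactGroups.Isotypic.integrable_smul_apply

variable [CompleteSpace E] [IsProbabilityMeasure μ]

/-- **The lift factors through the `χ̄`-isotypic projection** (PerL v5 ll. 493–494; adv2-C1(a):
"`θ(φ,χ') = θ(P_b φ, χ')`"): for a continuous linear `θ` with `θ (ω u φ) = (χ u)⁻¹ • θ φ`,
`θ (proj φ) = θ φ`. -/
theorem lift_proj (hω : ∀ v, Continuous fun k => ω k v) (hχ : Continuous χ) (θ : E →L[ℂ] F)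
    (hθ : ∀ u φ, θ (ω u φ) = ((χ u : ℂ))⁻¹ • θ φ) (φ : E) : θ (proj μ ω χ φ) = θ φ := by
  rw [proj_def, ← θ.integral_comp_comm (integrable_smul_apply μ ω χ hω hχ φ)]
  have : (fun k => θ ((χ k : ℂ) • ω k φ)) = fun _ => θ φ := by
    funext k
    rw [θ.map_smul, hθ, smul_smul, mul_inv_cancel₀ (Circle.coe_ne_zero (χ k)), one_smul]
  rw [this, integral_const]
  simp

/-- Hence a lift vanishes on every vector with zero `χ̄`-isotypic component ("only the `φ_b` in the
corresponding isotypic parts contribute", l. 494). -/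
theorem lift_eq_zero_of_proj_eq_zero (hω : ∀ v, Continuous fun k => ω k v) (hχ : Continuous χ)
    (θ : E →L[ℂ] F) (hθ : ∀ u φ, θ (ω u φ) = ((χ u : ℂ))⁻¹ • θ φ) {φ : E}
    (hφ : proj μ ω χ φ = 0) : θ φ = 0 := by
  rw [← lift_proj μ ω χ hω hχ θ hθ φ, hφ, map_zero]

end Lift

section SelfAdjoint

variable [TopologicalSpace K] [OpensMeasurableSpace K] [CompactSpace K] [IsFiniteMeasureOnCompacts μ]
variable [CompleteSpace E]

/-- `⟪v, proj w⟫ = ∫ χ k * ⟪v, ω k w⟫`. -/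
theorem inner_proj (hω : ∀ v, Continuous fun k => ω k v) (hχ : Continuous χ) (v w : E) :
    ⟪v, proj μ ω χ w⟫_ℂ = ∫ k, (χ k : ℂ) * ⟪v, ω k w⟫_ℂ ∂μ := by
  rw [proj_def, ← integral_inner (integrable_smul_apply μ ω χ hω hχ w)]
  congr 1
  funext k
  rw [inner_smul_right]

variable [MeasurableInv K] [μ.IsInvInvariant]

/-- **Self-adjointness** of the average: `⟪proj v, w⟫ = ⟪v, proj w⟫` (uses inversion-invariance of `μ`,
which holds for the Haar measure of every compact group and of every abelian group). -/
theorem inner_proj_comm (hω : ∀ v, Continuous fun k => ω k v) (hχ : Continuous χ) (v w : E) :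
    ⟪proj μ ω χ v, w⟫_ℂ = ⟪v, proj μ ω χ w⟫_ℂ := by
  rw [← inner_conj_symm, inner_proj μ ω χ hω hχ, inner_proj μ ω χ hω hχ, ← integral_conj]
  rw [← integral_inv_eq_self (fun k => (χ k : ℂ) * ⟪v, ω k w⟫_ℂ) μ]
  congr 1
  funext k
  rw [map_mul, inner_conj_symm, ← coe_map_inv]
  congr 1
  rw [LinearIsometryEquiv.inner_map_eq_flip, map_inv, LinearIsometryEquiv.inv_def]

end SelfAdjoint

section Rallis

variable [MeasurableMul K] [MeasurableInv K] [μ.IsMulLeftInvariant] [μ.IsInvInvariant]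
variable [TopologicalSpace K] [OpensMeasurableSpace K] [CompactSpace K] [IsProbabilityMeasure μ]
variable [CompleteSpace E]

/-- **PerL v5 l. 612–615 at a compact place**: the local Rallis factor
`I(φ) = ∫ χ(k) ⟨ω(k)φ, φ⟩ dk` equals `‖φ[χ̄]‖²`, the squared norm of the `χ̄`-isotypic component
(`vol = 1` for the probability Haar measure; `⟨x, y⟩` linear in `x` = Mathlib's `⟪y, x⟫`). -/
theorem integral_chi_inner_eq (hω : ∀ v, Continuous fun k => ω k v) (hχ : Continuous χ) (φ : E) :
    ∫ k, (χ k : ℂ) * ⟪φ, ω k φ⟫_ℂ ∂μ = ((‖proj μ ω χ φ‖ ^ 2 : ℝ) : ℂ) := by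
  rw [← inner_proj μ ω χ hω hχ, ← proj_proj μ ω χ φ, ← inner_proj_comm μ ω χ hω hχ,
    proj_proj, inner_self_eq_norm_sq_to_K]
  norm_cast

/-- Hence `I(φ) ≥ 0` … -/
alias integral_chi_inner_nonneg := Literature.RepresentationTheory.CompactGroups.Isotypic.integral_chi_inner_nonneg

/-- … and `I(φ) > 0` iff the `χ̄`-isotypic component of `φ` is non-zero (PerL v5 l. 613–615 "it is `>0`
for suitable `φ_v` … `I_v(φ_v) = vol · ‖φ_v[χ̄'_v]‖²` … non-zero for suitable `φ_v`"). -/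
theorem integral_chi_inner_pos_iff (hω : ∀ v, Continuous fun k => ω k v) (hχ : Continuous χ) (φ : E) :
    0 < (∫ k, (χ k : ℂ) * ⟪φ, ω k φ⟫_ℂ ∂μ).re ↔ proj μ ω χ φ ≠ 0 := by
  rw [integral_chi_inner_eq μ ω χ hω hχ, Complex.ofReal_re]
  constructor
  · intro h h0
    rw [h0, norm_zero] at h
    norm_num at h
  · intro h
    have : 0 < ‖proj μ ω χ φ‖ := norm_pos_iff.mpr h
    positivity

/-- In particular `I(φ) > 0` for every non-zero `χ̄`-isotypic vector `φ` (the "suitable `φ_v`" of l. 613: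
at a real place `φ_b = φ⁰_{i,b}`, at a non-split finite place any vector in an occurring isotypic part). -/
theorem integral_chi_inner_pos_of_mem (hω : ∀ v, Continuous fun k => ω k v) (hχ : Continuous χ)
    {φ : E} (hφ : φ ∈ isoSub ω χ) (hne : φ ≠ 0) :
    0 < (∫ k, (χ k : ℂ) * ⟪φ, ω k φ⟫_ℂ ∂μ).re := by
  rw [integral_chi_inner_pos_iff μ ω χ hω hχ, proj_eq_self μ ω χ hφ]
  exact hne

end Rallis

end Isotypic
end PerL34
end HodgeCM

end
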